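import Literature.AnabelianGeometry.EtaleTheta.Discharge.Sec5CyclotomicRigidityOfBiKummerDataLaws
import Literature.AnabelianGeometry.EtaleTheta.Discharge.Sec5Thm56OfBiKummerData
import Literature.AnabelianGeometry.EtaleTheta.Discharge.Sec5Prop55RoofIndependentOfLaws
import Literature.AnabelianGeometry.EtaleTheta.Discharge.Sec5Thm56OfRoofs
import HarnessLib

/-!
# [EtTh] Prop. 5.5 and Thm. 5.6 at the assembled §5 data `ofBiKummerData`, ROOF FORM: the fixed-source transport step
# `hreach : LinearlyReachableFromBN` replaced by print's roofs `S″ → S`, `S″ → B_N` (proof-only)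

S. Mochizuki, *The étale theta function and its Frobenioid-theoretic manifestations*, Publ. RIMS **45** (2009) [MochizukiEtTh2009],
Prop. 5.5 p.327, proof p.328 (PDF p.102) l.2–11 («by means of linear morphisms `S″ → S`, `S″ → S′` … which induce isomorphisms …
independent of the choice of `S′`, `S″`, and the linear morphisms»); Thm. 5.6 p.328, proof p.329 (PDF p.103) l.23–27.

abc-iut cell, layer L2, seat abc-iut-w5-d013 (gen 6), self-named row #3; sequel of `Sec5Prop55RoofIndependentOfLaws.lean` (p460420)
and `Sec5Thm56OfRoofs.lean` (p461205), which put the abstract Prop. 5.5 / Thm. 5.6 (i) chain heads in roof form.  THIS FILE carries the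
swap ONE level up, to abc-iut-L2-t4's assembled §5 datum `ThetaFrobenioid.ofBiKummerData …` — the level at which the K4 knits
(`Sec5Thm56OfBiKummerDataAllLeaves*`, `…Capstone`, `…EndKnit*`) consume Prop. 5.5 / Thm. 5.6: ROOF TWINS of abc-iut-w5-d020's
`cyclotomicRigidity_ofBiKummerData_of_laws` (`Sec5CyclotomicRigidityOfBiKummerDataLaws.lean`) and `cyclotomicRigidityPreserved_ofBiKummerData`
(`Sec5Thm56OfBiKummerData.lean`).  PROOF-ONLY (no definition, no new named fact); the originals are NOT edited; every by-name discharge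
at the data is theirs, verbatim (`exists_eta_etaTautological_ofBiKummerData`, `unitsCentralUnderLDelta_ofBiKummerData`, `unitsPull*_ofBiKummerData`,
`lDeltaCovered_ofBiKummerData`, `sgpCapSection_ofBiKummerData`, `sgpCapSpec/sgpCupSpec_ofBiKummerData`, `deltaTransportCompat_ofBiKummerData`,
`ModelFrobenioid.unitsPull_congr_baseMap`, `epi_of_model`).

WHAT IS PROVED:
* `Thm56Sub.roofs_bijective_of` (abstract datum) — «which induce isomorphisms» for ROOFS: legs with `Δ-push` onto and `μ-pull` injective
  between `(l, N)`-theta-saturated objects are BIJECTIVE on `(l·Δ_Θ) ⊗ ℤ/Nℤ` and `μ_N` (Def. 5.4 (a)(b): `N` elements at both ends;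
  the roof twin of abc-iut-w5-d020's `bijectivelyReachableFromBN_of`);
* `cyclotomicRigidity_ofBiKummerData_of_laws_roofs` — **[EtTh] Prop. 5.5 (`CyclotomicRigidity (ofBiKummerData …) P hB`) with
  `hreach ↦ {hroof, hmeet}` and `hgal` (out, at `B_N ⟶ T`) `↦ hgalIn` (in, at `R″ ⟶ B_N`: `B_N` is Galois — Def. 4.1 (ii) p.313 (PDF
  p.87) «We shall say that `A` is Galois if `A^bs ∈ Ob(D)` is Galois», used for `B_N` through «the natural outer homomorphism `Π^tp_X ↠
  Aut_D(B_N^bs)` [cf. Definition 4.1, (ii)]», p.331 (PDF p.105); the clause is [SemiAnbd] Def. 3.1 (iv) verbatim — a THEOREM over the genuine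
  base `B^temp(Π)⁰`, `galoisIn_of_isGaloisObj_connectedPart`)**; every other binder verbatim w5-d020's;
* `cyclotomicRigidityPreserved_ofBiKummerData_roofs` — **[EtTh] Thm. 5.6 (`CyclotomicRigidityPreserved (ofBiKummerData …) Ψ ρ aΨ`)
  with `hreach ↦ hroof` and abc-iut-L2-d4's `hpull` asked at LINEAR `φ` only** (a theorem at the genuine data:
  `hpull_of_isLinear_ofConnectedTemperoidData`, p449195); every other binder verbatim w5-d020's.
So a knit adopting these two drop-ins loses the depth-constrained `hreach` (F-w5d013g5-1) and the all-`φ` `hpull` from its binder list,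
gaining `hroof` (one roof per theta-saturated `S`), `hmeet` (two roofs of `T` meet) and, over an abstract base, `hgalIn`.
HONEST FRAMING: kernel-checked implications between typed statements about the assembled §5 data; the roofs, their meeting and the other
binders are HYPOTHESES, not asserted; nothing asserts that such data exist for an actual curve; [EtTh]/[SemiAnbd] are refereed pre-IUT
material; nothing here bears on [IUTchIII] Cor. 3.12 — no side is taken; typed ≠ proved.
-/

noncomputable section

namespace Literature.AnabelianGeometry.EtaleTheta

open CategoryTheory Opposite FrobenioidCyclotomicRigidity Literature.AlgebraicGeometry.Frobenioids

namespace ThetaFrobenioid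

/-! ### «which induce isomorphisms» for roofs (Def. 5.4 (a)(b) cardinalities) -/

namespace Thm56Sub

section Abstract

universe w v v' u u'

variable {C : Type u} [Category.{v} C] {D : Type u'} [Category.{v'} D] (𝔉 : ThetaFrobenioid.{w} C D)

/-- **Roof legs «induce isomorphisms»** (Prop. 5.5 proof p.328 (PDF p.102) l.5–7): a roof `B_N ⟵b R a⟶ S` of linear morphisms from a
theta-saturated `R` whose legs are onto on `(l·Δ_Θ) ⊗ ℤ/Nℤ` and injective on `μ_N` has BIJECTIVE legs — both ends have `N` elements
(Def. 5.4 (b), `IsThetaSaturated.card_lDeltaModN`; Def. 5.4 (a), `card_muTorsion_eq`); the roof twin of abc-iut-w5-d020's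
`bijectivelyReachableFromBN_of`.  [cite: MochizukiEtTh2009, Prop 5.5 proof p.328 (PDF p.102)] -/
theorem roofs_bijective_of (hB : 𝔉.IsThetaSaturated 𝔉.BN)
    (hroof : ∀ S : C, 𝔉.IsThetaSaturated S → ∃ (R : C) (_ : 𝔉.IsThetaSaturated R) (a : R ⟶ S) (b : R ⟶ 𝔉.BN),
      𝔉.IsLinear a ∧ 𝔉.IsLinear b ∧ Function.Surjective (𝔉.lDeltaModNMap a) ∧ Function.Injective (𝔉.muTorsionPull a 𝔉.N) ∧
        Function.Surjective (𝔉.lDeltaModNMap b) ∧ Function.Injective (𝔉.muTorsionPull b 𝔉.N))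
    (S : C) (hS : 𝔉.IsThetaSaturated S) :
    ∃ (R : C) (_ : 𝔉.IsThetaSaturated R) (a : R ⟶ S) (b : R ⟶ 𝔉.BN),
      𝔉.IsLinear a ∧ 𝔉.IsLinear b ∧ Function.Bijective (𝔉.lDeltaModNMap a) ∧ Function.Bijective (𝔉.muTorsionPull a 𝔉.N) ∧
        Function.Bijective (𝔉.lDeltaModNMap b) ∧ Function.Bijective (𝔉.muTorsionPull b 𝔉.N) := by
  have hl : 0 < 𝔉.l := 𝔉.odd_l.pos
  obtain ⟨R, hR, a, b, ha, hb, hΔa, hμa, hΔb, hμb⟩ := hroof S hS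
  haveI : Finite (𝔉.lDeltaModN R) :=
    Nat.finite_of_card_ne_zero (by rw [hR.card_lDeltaModN]; exact 𝔉.N.ne_zero)
  haveI : Finite (𝔉.muTorsion R 𝔉.N) :=
    Nat.finite_of_card_ne_zero (by rw [card_muTorsion_eq 𝔉 hl hR.muSaturated]; exact 𝔉.N.ne_zero)
  exact ⟨R, hR, a, b, ha, hb,
    hΔa.bijective_of_nat_card_le (by rw [hR.card_lDeltaModN, hS.card_lDeltaModN]),
    hμa.bijective_of_nat_card_le (by rw [card_muTorsion_eq 𝔉 hl hR.muSaturated, card_muTorsion_eq 𝔉 hl hS.muSaturated]),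
    hΔb.bijective_of_nat_card_le (by rw [hR.card_lDeltaModN, hB.card_lDeltaModN]),
    hμb.bijective_of_nat_card_le (by rw [card_muTorsion_eq 𝔉 hl hR.muSaturated, card_muTorsion_eq 𝔉 hl hB.muSaturated])⟩

/-- The uniqueness-side roof shape (`S″ ⟶ B_N` first, then `S″ ⟶ S` onto/injective — this seat's `rigidityFamily_unique_of_roof`,
`cyclotomicRigidityPreserved_of_roofs`) read off the existence-side one.  [cite: MochizukiEtTh2009, Prop 5.5 proof p.328 (PDF p.102)] -/
theorem roofs_flip_of
    (hroof : ∀ S : C, 𝔉.IsThetaSaturated S → ∃ (R : C) (_ : 𝔉.IsThetaSaturated R) (a : R ⟶ S) (b : R ⟶ 𝔉.BN),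
      𝔉.IsLinear a ∧ 𝔉.IsLinear b ∧ Function.Surjective (𝔉.lDeltaModNMap a) ∧ Function.Injective (𝔉.muTorsionPull a 𝔉.N) ∧
        Function.Surjective (𝔉.lDeltaModNMap b) ∧ Function.Injective (𝔉.muTorsionPull b 𝔉.N))
    (S : C) (hS : 𝔉.IsThetaSaturated S) :
    ∃ (S'' : C) (_ : 𝔉.IsThetaSaturated S'') (φ : S'' ⟶ 𝔉.BN) (ψ : S'' ⟶ S),
      𝔉.IsLinear φ ∧ 𝔉.IsLinear ψ ∧ Function.Surjective (𝔉.lDeltaModNMap ψ) ∧ Function.Injective (𝔉.muTorsionPull ψ 𝔉.N) := by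
  obtain ⟨R, hR, a, b, ha, hb, hΔa, hμa, -, -⟩ := hroof S hS
  exact ⟨R, hR, b, a, hb, ha, hΔa, hμa⟩

end Abstract

end Thm56Sub

/-! ### Prop. 5.5 and Thm. 5.6 at `ofBiKummerData`, roof form -/

universe u₀ v₀ u v w

variable {K : Type u₀} [Field K]
  {X : SemiGraphs.TemperedArithmeticGroup.{u₀} K} {D₀ : Type u₀} [Category.{v₀} D₀]
  {V : FrdIMonoidStub.{w}} {T₀ : RealifiedDivisorMonoids (D₀ := D₀) V} {D : Type u} [Category.{v} D]
  {VD : FrdICatStub.{u, v, w} D} {S : BiKummerSetting X T₀ D VD}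
  {pullFrac : ∀ {A A' : S.C} (_ : A' ⟶ A), S.biratUnits A → S.biratUnits A'}
  {lv N : ℕ+} {l' : ℕ} {RD : RigidData.{max v w} N l'} {θ : S.biratUnits S.Aodot} {Bl : S.C}
  {Pl : S.FractionPair θ Bl} {Rl : S.NthRoot θ Pl lv pullFrac}
  (h : ModelFrobenioid.Hypotheses S.tf.divisorMonoid S.tf.ratFnFunctor)
  (toB : ∀ A : S.C, S.biratUnits A →* S.tf.biratUnitsModel A) (Q : FrobenioidTheta.ThetaSubquotientStub.{w} D)
  (odd_l : Odd (lv : ℕ)) (R : S.NthRoot Rl.root Rl.pair N pullFrac) (ιX : RD.PiX ≃ₜ* X.Pi)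
  (hopen : IsOpen ((S.galoisSurj R.AN.base R.αData.isGalois).ker : Set X.Pi)) (σ : Aut R.AN.base →* Aut R.AN)
  (K' : Type w) [Field K'] (constEmb : K'ˣ →* S.tf.biratUnitsModel R.BN)
  (constEmb_injective : Function.Injective constEmb)
  (hdivc : ∀ g : Aut R.BN.base,
    ModelFrobenioid.div ((σ ((BiKummerSetting.NthRoot.baseIso S R).conjAut.symm g)).hom ≫ R.pair.num) =
      ModelFrobenioid.div R.pair.num)
  (hdivp : ∀ y : RD.PiYdd,
    ModelFrobenioid.div ((σ (S.galoisSurj R.AN.base R.αData.isGalois (ιX y.1))).hom ≫ R.pair.den) =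
      ModelFrobenioid.div R.pair.den)

/-- **[EtTh] Proposition 5.5 for the ASSEMBLED §5 data, ROOF FORM** — abc-iut-w5-d020's `cyclotomicRigidity_ofBiKummerData_of_laws`
with the fixed-source transport step `hreach : LinearlyReachableFromBN` (a depth constraint over `B^temp(Π)⁰`, F-w5d013g5-1) REPLACED by
print's roofs: `hroof` — every theta-saturated `S` admits a roof `B_N ⟵b R a⟶ S` of linear morphisms from a theta-saturated `R`, legs onto on
`(l·Δ_Θ) ⊗ ℤ/Nℤ` and injective on `μ_N` (upgraded to bijective by `Thm56Sub.roofs_bijective_of`) — and `hmeet` — two roofs of `T` meet at a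
theta-saturated `R″` over one base map — and with the out-transitivity `hgal` replaced by the in-transitivity `hgalIn` (`B_N` is Galois:
Def. 4.1 (ii) p.313 (PDF p.87), invoked for `B_N` on p.331 (PDF p.105) «`Π^tp_X ↠ Aut_D(B_N^bs)` [cf. Definition 4.1, (ii)]»; the clause is
[SemiAnbd] Def. 3.1 (iv)); via this seat's `Thm56Sub.cyclotomicRigidity_of_laws_roofs`.  All other binders and by-name discharges exactly as
in `cyclotomicRigidity_ofBiKummerData_of_laws`.  [cite: MochizukiEtTh2009, Prop 5.5 p.327–328 (PDF pp.101–102); Def 4.1 (ii) p.313 (PDF p.87)]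
[cite: MochizukiSemiAnbd2006, Def 3.1(iv) p.33] -/
theorem cyclotomicRigidity_ofBiKummerData_of_laws_roofs
    (hB : (ofBiKummerData h toB Q odd_l R ιX hopen σ K' constEmb constEmb_injective hdivc hdivp).IsThetaSaturated
      (ofBiKummerData h toB Q odd_l R ιX hopen σ K' constEmb constEmb_injective hdivc hdivp).BN)
    (P : ThetaSubquotientProj (ofBiKummerData h toB Q odd_l R ιX hopen σ K' constEmb constEmb_injective hdivc hdivp))
    -- the η-side (abc-iut-w5-d123, P55-L02 at the carrier) and coverage
    {η₀ : RD.PiYdd → RD.mu} (hη₀ : η₀ ∈ RD.thetaCocycles)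
    (hdies : ∀ k : RD.PiYdd, rhoOfBiKummerData R ιX k = 1 → η₀ k = 1)
    (e : RD.mu → (ofBiKummerData h toB Q odd_l R ιX hopen σ K' constEmb constEmb_injective hdivc hdivp).lDeltaModN
      (ofBiKummerData h toB Q odd_l R ιX hopen σ K' constEmb constEmb_injective hdivc hdivp).BN)
    (he : Function.Surjective e)
    (hlift : ∀ a ∈ (ofBiKummerData h toB Q odd_l R ιX hopen σ K' constEmb constEmb_injective hdivc hdivp).HB,
      a ∈ P.pre _ → ∃ k : RD.PiYdd, (k : RD.PiX) ∈ RD.lDeltaTheta ∧ rhoOfBiKummerData R ιX k = a)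
    (hpre : ∀ k : RD.PiYdd, (k : RD.PiX) ∈ RD.lDeltaTheta → rhoOfBiKummerData R ιX k ∈ P.pre _)
    (hP : ∀ (k : RD.PiYdd) (hk : (k : RD.PiX) ∈ RD.lDeltaTheta) (hm : rhoOfBiKummerData R ιX k ∈ P.pre _),
      (QuotientGroup.mk (P.proj _ ⟨rhoOfBiKummerData R ιX k, hm⟩) :
          (ofBiKummerData h toB Q odd_l R ιX hopen σ K' constEmb constEmb_injective hdivc hdivp).lDeltaModN
            (ofBiKummerData h toB Q odd_l R ιX hopen σ K' constEmb constEmb_injective hdivc hdivp).BN) =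
        e (RD.thetaMod ⟨k, hk⟩))
    -- the ν-half of the Prop. 5.2 (iii) pin, for the descended η
    (ν : (ofBiKummerData h toB Q odd_l R ιX hopen σ K' constEmb constEmb_injective hdivc hdivp).lDeltaModN
        (ofBiKummerData h toB Q odd_l R ιX hopen σ K' constEmb constEmb_injective hdivc hdivp).BN ≃*
      (ofBiKummerData h toB Q odd_l R ιX hopen σ K' constEmb constEmb_injective hdivc hdivp).muTorsion
        (ofBiKummerData h toB Q odd_l R ιX hopen σ K' constEmb constEmb_injective hdivc hdivp).BN
        (ofBiKummerData h toB Q odd_l R ιX hopen σ K' constEmb constEmb_injective hdivc hdivp).N)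
    (hK : ∀ η : (ofBiKummerData h toB Q odd_l R ιX hopen σ K' constEmb constEmb_injective hdivc hdivp).HB →
        (ofBiKummerData h toB Q odd_l R ιX hopen σ K' constEmb constEmb_injective hdivc hdivp).lDeltaModN
          (ofBiKummerData h toB Q odd_l R ιX hopen σ K' constEmb constEmb_injective hdivc hdivp).BN,
      (∀ k : RD.PiYdd, η ⟨rhoOfBiKummerData R ιX k, Subgroup.mem_map_of_mem _ k.2⟩ = e (η₀ k)) →
        FrobenioidThetaBiKummer.ThetaPairKummerClass
          (ofBiKummerData h toB Q odd_l R ιX hopen σ K' constEmb constEmb_injective hdivc hdivp) η ν)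
    -- centrality of the geometric part (abc-iut-w5-d020, T56-L09b at the data)
    (hσ : ∀ g : Aut R.AN.base, ModelFrobenioid.baseMap (σ g).hom = g.hom)
    (hgeom : P.pre R.BN.base ≤ RD.aug.ker.map (rhoOfBiKummerData R ιX))
    (hconst : ∀ δ ∈ RD.aug.ker, ∀ τ : ModelFrobenioid.units R.BN,
      (S.tf.ratFnFunctor.map (rhoOfBiKummerData R ιX δ).hom.op).hom (ModelFrobenioid.unit τ.1.hom) =
        ModelFrobenioid.unit τ.1.hom)
    -- print's ROOFS (replacing `hreach`): one roof per theta-saturated `S`, and two roofs of `T` meet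
    (hroof : ∀ T : S.C,
      (ofBiKummerData h toB Q odd_l R ιX hopen σ K' constEmb constEmb_injective hdivc hdivp).IsThetaSaturated T →
      ∃ (R' : S.C) (_ : (ofBiKummerData h toB Q odd_l R ιX hopen σ K' constEmb constEmb_injective hdivc hdivp).IsThetaSaturated R')
        (a : R' ⟶ T) (b : R' ⟶ (ofBiKummerData h toB Q odd_l R ιX hopen σ K' constEmb constEmb_injective hdivc hdivp).BN),
        (ofBiKummerData h toB Q odd_l R ιX hopen σ K' constEmb constEmb_injective hdivc hdivp).IsLinear a ∧
        (ofBiKummerData h toB Q odd_l R ιX hopen σ K' constEmb constEmb_injective hdivc hdivp).IsLinear b ∧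
        Function.Surjective ((ofBiKummerData h toB Q odd_l R ιX hopen σ K' constEmb constEmb_injective hdivc hdivp).lDeltaModNMap a) ∧
        Function.Injective ((ofBiKummerData h toB Q odd_l R ιX hopen σ K' constEmb constEmb_injective hdivc hdivp).muTorsionPull a
          (ofBiKummerData h toB Q odd_l R ιX hopen σ K' constEmb constEmb_injective hdivc hdivp).N) ∧
        Function.Surjective ((ofBiKummerData h toB Q odd_l R ιX hopen σ K' constEmb constEmb_injective hdivc hdivp).lDeltaModNMap b) ∧
        Function.Injective ((ofBiKummerData h toB Q odd_l R ιX hopen σ K' constEmb constEmb_injective hdivc hdivp).muTorsionPull b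
          (ofBiKummerData h toB Q odd_l R ιX hopen σ K' constEmb constEmb_injective hdivc hdivp).N))
    (hmeet : ∀ (T : S.C),
      (ofBiKummerData h toB Q odd_l R ιX hopen σ K' constEmb constEmb_injective hdivc hdivp).IsThetaSaturated T →
      ∀ (R₁ : S.C), (ofBiKummerData h toB Q odd_l R ιX hopen σ K' constEmb constEmb_injective hdivc hdivp).IsThetaSaturated R₁ →
      ∀ (a : R₁ ⟶ T), (ofBiKummerData h toB Q odd_l R ιX hopen σ K' constEmb constEmb_injective hdivc hdivp).IsLinear a →
      ∀ (R₂ : S.C), (ofBiKummerData h toB Q odd_l R ιX hopen σ K' constEmb constEmb_injective hdivc hdivp).IsThetaSaturated R₂ →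
      ∀ (a' : R₂ ⟶ T), (ofBiKummerData h toB Q odd_l R ιX hopen σ K' constEmb constEmb_injective hdivc hdivp).IsLinear a' →
      ∃ (R₀ : S.C) (_ : (ofBiKummerData h toB Q odd_l R ιX hopen σ K' constEmb constEmb_injective hdivc hdivp).IsThetaSaturated R₀)
        (c : R₀ ⟶ R₁) (c' : R₀ ⟶ R₂),
        (ofBiKummerData h toB Q odd_l R ιX hopen σ K' constEmb constEmb_injective hdivc hdivp).IsLinear c ∧
        (ofBiKummerData h toB Q odd_l R ιX hopen σ K' constEmb constEmb_injective hdivc hdivp).IsLinear c' ∧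
        (ofBiKummerData h toB Q odd_l R ιX hopen σ K' constEmb constEmb_injective hdivc hdivp).base.map (c ≫ a) =
          (ofBiKummerData h toB Q odd_l R ιX hopen σ K' constEmb constEmb_injective hdivc hdivp).base.map (c' ≫ a') ∧
        Function.Surjective ((ofBiKummerData h toB Q odd_l R ιX hopen σ K' constEmb constEmb_injective hdivc hdivp).lDeltaModNMap c') ∧
        Function.Injective ((ofBiKummerData h toB Q odd_l R ιX hopen σ K' constEmb constEmb_injective hdivc hdivp).muTorsionPull c'
          (ofBiKummerData h toB Q odd_l R ιX hopen σ K' constEmb constEmb_injective hdivc hdivp).N))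
    -- the laws of the free subquotient stub
    (hLc : Thm56Sub.LDeltaMapComp
      (ofBiKummerData h toB Q odd_l R ιX hopen σ K' constEmb constEmb_injective hdivc hdivp))
    (hLi : Thm56Sub.LDeltaMapId
      (ofBiKummerData h toB Q odd_l R ιX hopen σ K' constEmb constEmb_injective hdivc hdivp))
    -- the structural leaves that stay NAMED at the data: (G-in) «B_N^bs is Galois», `hproj`, `hcup`
    (hgalIn : ∀ (T : S.C),
      (ofBiKummerData h toB Q odd_l R ιX hopen σ K' constEmb constEmb_injective hdivc hdivp).IsThetaSaturated T →
      ∀ (φ φ' : T ⟶ (ofBiKummerData h toB Q odd_l R ιX hopen σ K' constEmb constEmb_injective hdivc hdivp).BN),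
        (ofBiKummerData h toB Q odd_l R ιX hopen σ K' constEmb constEmb_injective hdivc hdivp).IsLinear φ →
        (ofBiKummerData h toB Q odd_l R ιX hopen σ K' constEmb constEmb_injective hdivc hdivp).IsLinear φ' →
          ∃ g : Aut ((ofBiKummerData h toB Q odd_l R ιX hopen σ K' constEmb constEmb_injective hdivc hdivp).base.obj
              (ofBiKummerData h toB Q odd_l R ιX hopen σ K' constEmb constEmb_injective hdivc hdivp).BN),
            (ofBiKummerData h toB Q odd_l R ιX hopen σ K' constEmb constEmb_injective hdivc hdivp).base.map φ' =
              (ofBiKummerData h toB Q odd_l R ιX hopen σ K' constEmb constEmb_injective hdivc hdivp).base.map φ ≫ g.hom)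
    (hproj : ∀ (g g' : Aut ((ofBiKummerData h toB Q odd_l R ιX hopen σ K' constEmb constEmb_injective hdivc hdivp).base.obj
        (ofBiKummerData h toB Q odd_l R ιX hopen σ K' constEmb constEmb_injective hdivc hdivp).BN))
        (hh : g' ∈ P.pre _), ∃ hgh : g * g' * g⁻¹ ∈ P.pre _,
          (ofBiKummerData h toB Q odd_l R ιX hopen σ K' constEmb constEmb_injective hdivc hdivp).lDeltaMap g.hom
              (P.proj _ ⟨g', hh⟩) = P.proj _ ⟨g * g' * g⁻¹, hgh⟩)
    (hcup : ∀ (g : Aut ((ofBiKummerData h toB Q odd_l R ιX hopen σ K' constEmb constEmb_injective hdivc hdivp).base.obj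
        (ofBiKummerData h toB Q odd_l R ιX hopen σ K' constEmb constEmb_injective hdivc hdivp).BN))
        (k : (ofBiKummerData h toB Q odd_l R ιX hopen σ K' constEmb constEmb_injective hdivc hdivp).HB),
        (k : Aut ((ofBiKummerData h toB Q odd_l R ιX hopen σ K' constEmb constEmb_injective hdivc hdivp).base.obj
          (ofBiKummerData h toB Q odd_l R ιX hopen σ K' constEmb constEmb_injective hdivc hdivp).BN)) ∈ P.pre _ →
        ∃ hmem : g * (k : Aut ((ofBiKummerData h toB Q odd_l R ιX hopen σ K' constEmb constEmb_injective hdivc hdivp).base.obj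
            (ofBiKummerData h toB Q odd_l R ιX hopen σ K' constEmb constEmb_injective hdivc hdivp).BN)) * g⁻¹ ∈
            (ofBiKummerData h toB Q odd_l R ιX hopen σ K' constEmb constEmb_injective hdivc hdivp).HB,
          (ofBiKummerData h toB Q odd_l R ιX hopen σ K' constEmb constEmb_injective hdivc hdivp).sgpCup
              ⟨g * (k : Aut ((ofBiKummerData h toB Q odd_l R ιX hopen σ K' constEmb constEmb_injective hdivc hdivp).base.obj
                (ofBiKummerData h toB Q odd_l R ιX hopen σ K' constEmb constEmb_injective hdivc hdivp).BN)) * g⁻¹, hmem⟩ =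
            (ofBiKummerData h toB Q odd_l R ιX hopen σ K' constEmb constEmb_injective hdivc hdivp).sgpCap g *
              (ofBiKummerData h toB Q odd_l R ιX hopen σ K' constEmb constEmb_injective hdivc hdivp).sgpCup k *
              ((ofBiKummerData h toB Q odd_l R ιX hopen σ K' constEmb constEmb_injective hdivc hdivp).sgpCap g)⁻¹) :
    CyclotomicRigidity (ofBiKummerData h toB Q odd_l R ιX hopen σ K' constEmb constEmb_injective hdivc hdivp) P hB := by
  -- the descended, tautological η (abc-iut-w5-d123)
  obtain ⟨η, hηdesc, hηtaut⟩ := exists_eta_etaTautological_ofBiKummerData h toB Q odd_l R ιX hopen σ K' constEmb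
    constEmb_injective hdivc hdivp hη₀ hdies e P hlift hP
  exact Thm56Sub.cyclotomicRigidity_of_laws_roofs P hB (hK η hηdesc) hηtaut
    (unitsCentralUnderLDelta_ofBiKummerData h toB Q odd_l R ιX hopen σ K' constEmb constEmb_injective hdivc hdivp
      hσ P hgeom hconst)
    (Thm56Sub.roofs_bijective_of _ hB hroof) hmeet
    (unitsPullComp_ofBiKummerData h toB Q odd_l R ιX hopen σ K' constEmb constEmb_injective hdivc hdivp)
    (unitsPullId_ofBiKummerData h toB Q odd_l R ιX hopen σ K' constEmb constEmb_injective hdivc hdivp) hLc hLi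
    (unitsPullSpec_ofBiKummerData h toB Q odd_l R ιX hopen σ K' constEmb constEmb_injective hdivc hdivp)
    (lDeltaCovered_ofBiKummerData h toB Q odd_l R ιX hopen σ K' constEmb constEmb_injective hdivc hdivp e he P hpre hP)
    hgalIn (sgpCapSection_ofBiKummerData h toB Q odd_l R ιX hopen σ K' constEmb constEmb_injective hdivc hdivp hσ)
    (fun _ _ _ _ hb => ModelFrobenioid.unitsPull_congr_baseMap hb) hproj hcup

/-- **[EtTh] Theorem 5.6 at the assembled §5 data, ROOF FORM** — abc-iut-w5-d020's `cyclotomicRigidityPreserved_ofBiKummerData` with the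
fixed-source `hreach : LinearlyReachableFromBN` REPLACED by print's roofs `hroof` (T56-L10 via this seat's `rigidityFamily_unique_of_roof` /
`Thm56Sub.cyclotomicRigidityPreserved_of_sub_roofs`) and abc-iut-L2-d4's unit pull-back naturality `hpull` asked at LINEAR `φ` only; every
other binder and by-name discharge exactly as in `cyclotomicRigidityPreserved_ofBiKummerData`.
[cite: MochizukiEtTh2009, Thm 5.6 p.328–329 (PDF pp.102–103)] -/
theorem cyclotomicRigidityPreserved_ofBiKummerData_roofs
    (Ψ : S.C ≌ S.C) (Ψbs : D ⥤ D) [Ψbs.Faithful] (eΨ : Ψ.functor ⋙ (ofBiKummerData h toB Q odd_l R ιX hopen σ K' constEmb constEmb_injective hdivc hdivp).base ≅ (ofBiKummerData h toB Q odd_l R ιX hopen σ K' constEmb constEmb_injective hdivc hdivp).base ⋙ Ψbs)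
    (α : Ψ.functor.obj (ofBiKummerData h toB Q odd_l R ιX hopen σ K' constEmb constEmb_injective hdivc hdivp).AN ≅ (ofBiKummerData h toB Q odd_l R ιX hopen σ K' constEmb constEmb_injective hdivc hdivp).AN)
    (β : Ψ.functor.obj (ofBiKummerData h toB Q odd_l R ιX hopen σ K' constEmb constEmb_injective hdivc hdivp).BN ≅ (ofBiKummerData h toB Q odd_l R ιX hopen σ K' constEmb constEmb_injective hdivc hdivp).BN)
    (eA : (ofBiKummerData h toB Q odd_l R ιX hopen σ K' constEmb constEmb_injective hdivc hdivp).AN ≅ (ofBiKummerData h toB Q odd_l R ιX hopen σ K' constEmb constEmb_injective hdivc hdivp).AN) (Dp : Aut (ofBiKummerData h toB Q odd_l R ιX hopen σ K' constEmb constEmb_injective hdivc hdivp).BN)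
    (θΨ : Aut R.BN.base ≃* Aut R.BN.base)
    (aΨ : ∀ A : S.C, (ofBiKummerData h toB Q odd_l R ιX hopen σ K' constEmb constEmb_injective hdivc hdivp).lDeltaModN A ≃* (ofBiKummerData h toB Q odd_l R ιX hopen σ K' constEmb constEmb_injective hdivc hdivp).lDeltaModN (Ψ.functor.obj A))
    -- abc-iut-L2-d4's transport hypotheses on Ψ (`hpull` at LINEAR `φ` only)
    (hlin : PreFrobenioidData.PreservesMor Ψ.functor (ofBiKummerData h toB Q odd_l R ιX hopen σ K' constEmb constEmb_injective hdivc hdivp).IsLinear (ofBiKummerData h toB Q odd_l R ιX hopen σ K' constEmb constEmb_injective hdivc hdivp).IsLinear)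
    (haΨn : ∀ {A A' : S.C} (φ : A ⟶ A') (x : (ofBiKummerData h toB Q odd_l R ιX hopen σ K' constEmb constEmb_injective hdivc hdivp).lDeltaModN A),
      aΨ A' ((ofBiKummerData h toB Q odd_l R ιX hopen σ K' constEmb constEmb_injective hdivc hdivp).lDeltaModNMap φ x) = (ofBiKummerData h toB Q odd_l R ιX hopen σ K' constEmb constEmb_injective hdivc hdivp).lDeltaModNMap (Ψ.functor.map φ) (aΨ A x))
    (hpull : ∀ {A A' : S.C} (φ : A ⟶ A'),
      (ofBiKummerData h toB Q odd_l R ιX hopen σ K' constEmb constEmb_injective hdivc hdivp).IsLinear φ →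
      ∀ (u : (ofBiKummerData h toB Q odd_l R ιX hopen σ K' constEmb constEmb_injective hdivc hdivp).muTorsion A' (ofBiKummerData h toB Q odd_l R ιX hopen σ K' constEmb constEmb_injective hdivc hdivp).N)
      (hu : Ψ.functor.mapAut A' (u : Aut A') ∈ (ofBiKummerData h toB Q odd_l R ιX hopen σ K' constEmb constEmb_injective hdivc hdivp).muTorsion (Ψ.functor.obj A') (ofBiKummerData h toB Q odd_l R ιX hopen σ K' constEmb constEmb_injective hdivc hdivp).N),
      Ψ.functor.mapAut A ((ofBiKummerData h toB Q odd_l R ιX hopen σ K' constEmb constEmb_injective hdivc hdivp).muTorsionPull φ (ofBiKummerData h toB Q odd_l R ιX hopen σ K' constEmb constEmb_injective hdivc hdivp).N u : Aut A) =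
        ((ofBiKummerData h toB Q odd_l R ιX hopen σ K' constEmb constEmb_injective hdivc hdivp).muTorsionPull (Ψ.functor.map φ) (ofBiKummerData h toB Q odd_l R ιX hopen σ K' constEmb constEmb_injective hdivc hdivp).N ⟨_, hu⟩ : Aut (Ψ.functor.obj A)))
    -- print's ROOFS (replacing `hreach`)
    (hroof : ∀ T : S.C,
      (ofBiKummerData h toB Q odd_l R ιX hopen σ K' constEmb constEmb_injective hdivc hdivp).IsThetaSaturated T →
      ∃ (R' : S.C) (_ : (ofBiKummerData h toB Q odd_l R ιX hopen σ K' constEmb constEmb_injective hdivc hdivp).IsThetaSaturated R')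
        (a : R' ⟶ T) (b : R' ⟶ (ofBiKummerData h toB Q odd_l R ιX hopen σ K' constEmb constEmb_injective hdivc hdivp).BN),
        (ofBiKummerData h toB Q odd_l R ιX hopen σ K' constEmb constEmb_injective hdivc hdivp).IsLinear a ∧
        (ofBiKummerData h toB Q odd_l R ιX hopen σ K' constEmb constEmb_injective hdivc hdivp).IsLinear b ∧
        Function.Surjective ((ofBiKummerData h toB Q odd_l R ιX hopen σ K' constEmb constEmb_injective hdivc hdivp).lDeltaModNMap a) ∧
        Function.Injective ((ofBiKummerData h toB Q odd_l R ιX hopen σ K' constEmb constEmb_injective hdivc hdivp).muTorsionPull a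
          (ofBiKummerData h toB Q odd_l R ιX hopen σ K' constEmb constEmb_injective hdivc hdivp).N) ∧
        Function.Surjective ((ofBiKummerData h toB Q odd_l R ιX hopen σ K' constEmb constEmb_injective hdivc hdivp).lDeltaModNMap b) ∧
        Function.Injective ((ofBiKummerData h toB Q odd_l R ιX hopen σ K' constEmb constEmb_injective hdivc hdivp).muTorsionPull b
          (ofBiKummerData h toB Q odd_l R ιX hopen σ K' constEmb constEmb_injective hdivc hdivp).N))
    (hdiff : (ofBiKummerData h toB Q odd_l R ιX hopen σ K' constEmb constEmb_injective hdivc hdivp).BiKummerDifferenceMem)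
    (hT : α.inv ≫ Ψ.functor.map (ofBiKummerData h toB Q odd_l R ιX hopen σ K' constEmb constEmb_injective hdivc hdivp).sCap ≫ β.hom =
      eA.hom ≫ (ofBiKummerData h toB Q odd_l R ιX hopen σ K' constEmb constEmb_injective hdivc hdivp).sCap ≫ (1 : Aut (ofBiKummerData h toB Q odd_l R ιX hopen σ K' constEmb constEmb_injective hdivc hdivp).BN).hom)
    (hT' : α.inv ≫ Ψ.functor.map (ofBiKummerData h toB Q odd_l R ιX hopen σ K' constEmb constEmb_injective hdivc hdivp).sCup ≫ β.hom =
      eA.hom ≫ (ofBiKummerData h toB Q odd_l R ιX hopen σ K' constEmb constEmb_injective hdivc hdivp).sCup ≫ Dp.hom)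
    (hu : Dp ∈ (ofBiKummerData h toB Q odd_l R ιX hopen σ K' constEmb constEmb_injective hdivc hdivp).units (ofBiKummerData h toB Q odd_l R ιX hopen σ K' constEmb constEmb_injective hdivc hdivp).BN)
    (hstrv : (ofBiKummerData h toB Q odd_l R ιX hopen σ K' constEmb constEmb_injective hdivc hdivp).StrvTransport Ψ α eA θΨ)
    (hYdd : (ofBiKummerData h toB Q odd_l R ιX hopen σ K' constEmb constEmb_injective hdivc hdivp).HB.map θΨ.toMonoidHom = (ofBiKummerData h toB Q odd_l R ιX hopen σ K' constEmb constEmb_injective hdivc hdivp).HB)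
    (P : ThetaSubquotientProj (ofBiKummerData h toB Q odd_l R ιX hopen σ K' constEmb constEmb_injective hdivc hdivp))
    (hσ : ∀ g : Aut R.AN.base, ModelFrobenioid.baseMap (σ g).hom = g.hom)
    (hgeom : P.pre R.BN.base ≤ RD.aug.ker.map (rhoOfBiKummerData R ιX))
    (hconst : ∀ δ ∈ RD.aug.ker, ∀ τ : ModelFrobenioid.units R.BN,
      (S.tf.ratFnFunctor.map (rhoOfBiKummerData R ιX δ).hom.op).hom (ModelFrobenioid.unit τ.1.hom) =
        ModelFrobenioid.unit τ.1.hom)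
    (e : RD.mu → (ofBiKummerData h toB Q odd_l R ιX hopen σ K' constEmb constEmb_injective hdivc hdivp).lDeltaModN (ofBiKummerData h toB Q odd_l R ιX hopen σ K' constEmb constEmb_injective hdivc hdivp).BN)
    (he : Function.Surjective e)
    (hpre : ∀ k : RD.PiYdd, (k : RD.PiX) ∈ RD.lDeltaTheta → rhoOfBiKummerData R ιX k ∈ P.pre _)
    (hP : ∀ (k : RD.PiYdd) (hk : (k : RD.PiX) ∈ RD.lDeltaTheta) (hm : rhoOfBiKummerData R ιX k ∈ P.pre _),
      (QuotientGroup.mk (P.proj _ ⟨rhoOfBiKummerData R ιX k, hm⟩) : (ofBiKummerData h toB Q odd_l R ιX hopen σ K' constEmb constEmb_injective hdivc hdivp).lDeltaModN (ofBiKummerData h toB Q odd_l R ιX hopen σ K' constEmb constEmb_injective hdivc hdivp).BN) = e (RD.thetaMod ⟨k, hk⟩))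
    (hcov' : ∀ g ∈ P.pre ((ofBiKummerData h toB Q odd_l R ιX hopen σ K' constEmb constEmb_injective hdivc hdivp).base.obj (ofBiKummerData h toB Q odd_l R ιX hopen σ K' constEmb constEmb_injective hdivc hdivp).BN),
      ∃ k : RD.PiYdd, (k : RD.PiX) ∈ RD.lDeltaTheta ∧ rhoOfBiKummerData R ιX k = g)
    (γ : RD.PiX ≃ₜ* RD.PiX)
    (hγ : ∀ y : RD.PiX, θΨ (rhoOfBiKummerData R ιX y) = rhoOfBiKummerData R ιX (γ y))
    (hγL : RD.lDeltaTheta.map γ.toMulEquiv.toMonoidHom = RD.lDeltaTheta)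
    (haΨ : ∀ (k : RD.PiYdd) (hk : (k : RD.PiX) ∈ RD.lDeltaTheta) (hk' : γ k ∈ RD.lDeltaTheta),
      (ofBiKummerData h toB Q odd_l R ιX hopen σ K' constEmb constEmb_injective hdivc hdivp).lDeltaModNMap β.hom (aΨ _ (e (RD.thetaMod ⟨k, hk⟩))) = e (RD.thetaMod ⟨γ k, hk'⟩))
    (ρ : RigidityFamily (ofBiKummerData h toB Q odd_l R ιX hopen σ K' constEmb constEmb_injective hdivc hdivp))
    (hB : (ofBiKummerData h toB Q odd_l R ιX hopen σ K' constEmb constEmb_injective hdivc hdivp).IsThetaSaturated (ofBiKummerData h toB Q odd_l R ιX hopen σ K' constEmb constEmb_injective hdivc hdivp).BN)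
    (hK : IsKummerDetermined (ofBiKummerData h toB Q odd_l R ιX hopen σ K' constEmb constEmb_injective hdivc hdivp) P ρ hB) (hρ : IsFunctorialLinear (ofBiKummerData h toB Q odd_l R ιX hopen σ K' constEmb constEmb_injective hdivc hdivp) ρ) :
    CyclotomicRigidityPreserved (ofBiKummerData h toB Q odd_l R ιX hopen σ K' constEmb constEmb_injective hdivc hdivp) Ψ ρ aΨ := by
  haveI : Epi (ofBiKummerData h toB Q odd_l R ιX hopen σ K' constEmb constEmb_injective hdivc hdivp).sCap := epi_of_model (DivB := S.tf.divBNatTrans) h _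
  haveI : Epi (ofBiKummerData h toB Q odd_l R ιX hopen σ K' constEmb constEmb_injective hdivc hdivp).sCup := epi_of_model (DivB := S.tf.divBNatTrans) h _
  exact Thm56Sub.cyclotomicRigidityPreserved_of_sub_roofs Ψ α β eA Dp θΨ Ψbs eΨ aΨ ρ hB (Thm56Sub.roofs_flip_of _ hroof) hρ hlin
    haΨn hpull
    (sgpCapSpec_ofBiKummerData h toB Q odd_l R ιX hopen σ K' constEmb constEmb_injective hdivc hdivp)
    (sgpCupSpec_ofBiKummerData h toB Q odd_l R ιX hopen σ K' constEmb constEmb_injective hdivc hdivp)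
    hdiff hT hT' hu hstrv hYdd P
    (unitsCentralUnderLDelta_ofBiKummerData h toB Q odd_l R ιX hopen σ K' constEmb constEmb_injective hdivc hdivp
      hσ P hgeom hconst)
    (unitsPullSpec_ofBiKummerData h toB Q odd_l R ιX hopen σ K' constEmb constEmb_injective hdivc hdivp)
    (Thm56Sub.deltaTransportCompat_ofBiKummerData h toB Q odd_l R ιX hopen σ K' constEmb constEmb_injective hdivc hdivp
      e P hpre hP hcov' Ψ β aΨ θΨ γ hγ hγL haΨ)
    hK
    (lDeltaCovered_ofBiKummerData h toB Q odd_l R ιX hopen σ K' constEmb constEmb_injective hdivc hdivp e he P hpre hP)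

end ThetaFrobenioid

end Literature.AnabelianGeometry.EtaleTheta
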